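import Literature.NumberTheory.LFunctions.BurnolZetaSystemsHardy
import Literature.NumberTheory.LFunctions.BurnolMellinTailAverage
import Literature.NumberTheory.LFunctions.BurnolTailFactor
import Literature.NumberTheory.LFunctions.BurnolSonineFourier
import Literature.Analysis.FunctionSpaces.MellinFourierMultiplier
import HarnessLib

/-!
# Burnol 2004b Prop. 4.1 (ii): from `(s/(s−1))A^sℍ² × (s/(s−1))A^sℍ²` back to `L_a`
# (the `𝓕`-side of the repaired Prop. 4.1, `Burnol2004b_prop4_1R` clause (ii))

LINE 1 — LABEL: RH-FREE (Hardy-space / `L²` harmonic analysis of Burnol's extended Sonine spaces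
`L_a`; the Riemann zeta function does not occur). FRAMING (cell rh-crit, D-0074): corpus theorems are
RH-FREE literature; nothing here is worded as progress toward RH. bears_on: B-C/B-P (LADDER-RH
COLUMN 6, de Branges framework) as a discharge of an as-printed corpus statement. WHAT THIS IS NOT:
not a route, not a criterion; nothing here bears on the truth of RH.

Source: J.-F. Burnol, *Two complete and minimal systems associated with the zeros of the Riemann zeta
function*, J. Théor. Nombres Bordeaux 16 (2004) 65–94 = arXiv:math/0203120v7 (`Burnol2004b`), §4
Prop. 4.1 and its proof, TeX of record `dbl/src/Burnol2004JTNB_arXivmath0203120v7.tex` l.646–669: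
"If a function `F(s)` belongs to `(s/(s−1))A^sℍ²` … it is the Mellin transform of an element `f(t)` of
`ℂ·𝟙_{0<t<a} + L²(a,∞;dt)`. If moreover `χ(s)F(1−s)` also belongs to `(s/(s−1))A^sℍ²`, then the
cosine transform of `f` is constant on `(0,a)` as well, so `f ∈ L_a`."

## What is proved (theorems only; no definition, no named fact)

* `BurnolHardyConverse.hasMellin_indicator_const` — `𝓜(c·𝟙_{(0,a]})(s) = c·a^s/s` (`Re s > 0`).
* `BurnolHardyConverse.exists_preimage` — the `t`-side packaged (gm-t5's
  `BurnolTailAvg.exists_sub_tailAvg_rightMellin_eq` + Hardy's inequality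
  `TailFactor.memLp_indicator_tailIntegral`): from `F ∈ ℍ²`, `F = a^s((s−1)/s)G` off `s = 1`, a
  function `f₀` with `f₀ = C` on `(0,a]`, `f₀·𝟙_{(a,∞)} ∈ L²`, `f̂₀ = G` on `½ < Re s < 1`.
* `BurnolHardyConverse.mellinL2_preimage_of_boundaryValues` — the Mellin–Plancherel transform of
  the `L²(0,∞)` class of `f₀` is `ξ ↦ G(½ − 2πiξ)` (LEFT convention of `MellinL2.mellinL2`: `𝓜f(s)`
  at `s = ½ + 2πiξ`, `f̂(s) = 𝓜f(1 − s)`), GIVEN the boundary-value lemma (B4) of the Mellin–Plancherel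
  theory for `L²(a,∞)` (hypothesis `hBV`, the row «dbl:R18-M3» statement
  `MellinPlancherelBoundaryValues` of the rh-crit dbl cell; the indicator part needs no boundary values).
* `BurnolHardyConverse.exists_mem_sonineL_of_boundaryValues` — **Prop. 4.1 (ii) with the `𝓕`-side
  export** (gm-t8's (ii′)): under (B4), for `G, H` holomorphic off `1` with
  `Γℝ(s)H(s) = Γℝ(1−s)G(1−s)` and both in `(s/(s−1))A^sℍ²` (pole-tolerant form of
  `Burnol2004b_prop4_1R`), there is `f ∈ L_a` with `f̂ = G` AND `(𝓕f)^ = H` on `½ < Re s < 1`.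
  Proof: even extensions `u, v` of the two preimages; by the multiplier identity
  `MellinFourierMultiplier.mellinL2_restrict_fourier_of_even` (row M2) and the functional equation on
  the critical line, `𝓜(res 𝓕u) = 𝓜(res v)`, so `𝓕u = v` (`𝓜` injective, both sides even).
* `BurnolHardyConverse.prop4_1R_ii_of_boundaryValues` — clause (ii) of `Burnol2004b_prop4_1R`
  verbatim, under (B4).

## References

* J.-F. Burnol, JTNB 16 (2004), Prop. 4.1 (arXiv:math/0203120v7 p. 7, TeX l.633–669) and §1 p. 4
  (TeX l.348–363, `𝓕₊(f)^(s) = χ(s)f̂(1−s)`). [key `Burnol2004b`]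
-/

noncomputable section

open MeasureTheory Complex Filter Set Real
open scoped Topology FourierTransform ENNReal

namespace Literature.NumberTheory.LFunctions

namespace BurnolHardyConverse

open Literature.Analysis.FunctionSpaces Literature.Analysis.FunctionSpaces.MellinL2
  Literature.Analysis.FunctionSpaces.MellinFourierMultiplier

variable {a : ℝ}

/-! ## A. The Mellin transform of `c·𝟙_{(0,a]}` -/

/-- `(c⁻¹)^{−s} = c^{s}` for a positive real `c` (principal powers). [folklore] -/
private theorem inv_ofReal_cpow_neg {c : ℝ} (hc : 0 < c) (s : ℂ) :
    ((c⁻¹ : ℝ) : ℂ) ^ (-s) = (c : ℂ) ^ s := by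
  rw [cpow_def_of_ne_zero (ofReal_ne_zero.2 (inv_pos.2 hc).ne'),
    cpow_def_of_ne_zero (ofReal_ne_zero.2 hc.ne'), ← ofReal_log (inv_pos.2 hc).le,
    ← ofReal_log hc.le, Real.log_inv]
  congr 1
  push_cast
  ring

/-- `c·𝟙_{(0,a]}(t) = c·𝟙_{(0,1]}(t/a)`. [folklore] -/
private theorem indicator_Ioc_eq_comp (ha : 0 < a) (c : ℂ) :
    ((Ioc 0 a).indicator fun _ : ℝ ↦ c) =
      fun t : ℝ ↦ c • (Ioc 0 1).indicator (fun _ : ℝ ↦ (1:ℂ)) (a⁻¹ * t) := by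
  funext t
  have key : a⁻¹ * t ∈ Ioc (0:ℝ) 1 ↔ t ∈ Ioc 0 a := by
    rw [mem_Ioc, mem_Ioc, inv_mul_le_iff₀ ha, mul_one, mul_pos_iff_of_pos_left (inv_pos.2 ha)]
  by_cases ht : t ∈ Ioc 0 a
  · rw [indicator_of_mem ht, indicator_of_mem (key.2 ht), smul_eq_mul, mul_one]
  · rw [indicator_of_notMem ht, indicator_of_notMem (fun h ↦ ht (key.1 h)), smul_zero]

/-- **`𝓜(c·𝟙_{(0,a]})(s) = c·a^s/s`** with absolute convergence, for `Re s > 0`, `a > 0`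
(`∫₀^a t^{s−1}dt = a^s/s`; Burnol: "`ℂ·𝟙_{0<t<a}` … `(s/(s−1))A^sℍ²`").
[cite: Burnol2004b, §4 before Prop. 4.1 (arXiv:math/0203120v7 p. 7, TeX l.638–643)] -/
theorem hasMellin_indicator_const (ha : 0 < a) (c : ℂ) {s : ℂ} (hs : 0 < s.re) :
    HasMellin ((Ioc 0 a).indicator fun _ : ℝ ↦ c) s (c * (a : ℂ) ^ s / s) := by
  have h1 := hasMellin_one_Ioc hs
  have hconv : MellinConvergent (fun t : ℝ ↦ (Ioc 0 1).indicator (fun _ : ℝ ↦ (1:ℂ)) (a⁻¹ * t)) s :=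
    (MellinConvergent.comp_mul_left (inv_pos.2 ha)).2 h1.1
  rw [indicator_Ioc_eq_comp ha c]
  refine ⟨hconv.const_smul c, ?_⟩
  rw [mellin_const_smul, mellin_comp_mul_left _ _ (inv_pos.2 ha), h1.2, smul_eq_mul, smul_eq_mul,
    inv_ofReal_cpow_neg ha]
  ring

/-! ## B. The even extension of a function given on `(0, ∞)` -/

/-- The even extension `u(x) = 𝟙_{x>0}f₀(x) + 𝟙_{−x>0}f₀(−x)` is even. [folklore] -/
private theorem evenExt_neg (f₀ : ℝ → ℂ) (x : ℝ) :
    (Ioi (0:ℝ)).indicator f₀ (-x) + (Ioi (0:ℝ)).indicator f₀ (-(-x)) =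
      (Ioi (0:ℝ)).indicator f₀ x + (Ioi (0:ℝ)).indicator f₀ (-x) := by
  rw [neg_neg, add_comm]

/-- The even extension agrees with `f₀` on `(0,∞)`. [folklore] -/
private theorem evenExt_of_pos (f₀ : ℝ → ℂ) {x : ℝ} (hx : 0 < x) :
    (Ioi (0:ℝ)).indicator f₀ x + (Ioi (0:ℝ)).indicator f₀ (-x) = f₀ x := by
  have h1 : x ∈ Ioi (0:ℝ) := hx
  have h2 : -x ∉ Ioi (0:ℝ) := fun h ↦ by
    have : (0:ℝ) < -x := h
    linarith
  rw [indicator_of_mem h1, indicator_of_notMem h2, add_zero]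

/-- The even extension of an `L²` function on `(0,∞)` is in `L²(ℝ)`. [folklore] -/
private theorem memLp_evenExt {f₀ : ℝ → ℂ} (h : MemLp ((Ioi (0:ℝ)).indicator f₀) 2 volume) :
    MemLp (fun x : ℝ ↦ (Ioi (0:ℝ)).indicator f₀ x + (Ioi (0:ℝ)).indicator f₀ (-x)) 2 volume :=
  h.add (h.comp_measurePreserving (Measure.measurePreserving_neg (volume : Measure ℝ)))

/-! ## C. The `t`-side: the preimage `f₀ ∈ ℂ·𝟙_{(0,a]} + L²(a,∞)` of `G` -/

/-- **The `t`-side of Prop. 4.1 (ii), packaged.** If `F ∈ ℍ²` and `F(s) = a^s((s−1)/s)G(s)` on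
`{Re s > ½} ∖ {1}`, there are `f₀ : ℝ → ℂ` and a constant `C` with: `f₀ = C` on `(0, a]`;
`𝟙_{(0,∞)}f₀ = C·𝟙_{(0,a]} + 𝟙_{(a,∞)}f₀` with both pieces (hence `𝟙_{(0,∞)}f₀`) in `L²`
(the second by Hardy's inequality); and `f̂₀(s) = G(s)` with absolute convergence on `½ < Re s < 1`
(gm-t5's `BurnolTailAvg.exists_sub_tailAvg_rightMellin_eq`: `f₀ = φ − Pφ`).
[cite: Burnol2004b, Prop. 4.1, proof (arXiv:math/0203120v7 p. 7, TeX l.656–669)] -/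
theorem exists_preimage (ha : 0 < a) {G : ℂ → ℂ}
    (hG2 : ∃ F : ℂ → ℂ, IsHardyRight F ∧ ∀ s : ℂ, 1 / 2 < s.re → s ≠ 1 →
      F s = (a : ℂ) ^ s * ((s - 1) / s) * G s) :
    ∃ (f₀ : ℝ → ℂ) (C : ℂ),
      (∀ t : ℝ, t ≤ a → f₀ t = C) ∧
      MemLp ((Ioi a).indicator f₀) 2 (volume : Measure ℝ) ∧
      ((Ioi (0:ℝ)).indicator f₀ =
        fun t : ℝ ↦ (Ioc 0 a).indicator (fun _ : ℝ ↦ C) t + (Ioi a).indicator f₀ t) ∧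
      MemLp ((Ioi (0:ℝ)).indicator f₀) 2 (volume : Measure ℝ) ∧
      ∀ s : ℂ, 1 / 2 < s.re → s.re < 1 → MellinConvergent f₀ (1 - s) ∧ rightMellin f₀ s = G s := by
  obtain ⟨F, hF, hFG⟩ := hG2
  obtain ⟨φ, hφm, hφ0, hφ2, -, hstrip⟩ := BurnolTailAvg.exists_sub_tailAvg_rightMellin_eq ha hF hFG
  have hφ0' : ∀ᵐ t : ℝ, t ≤ a → φ t = 0 := Eventually.of_forall hφ0
  set f₀ : ℝ → ℂ := fun t ↦ φ t - ∫ u in Ioi (max t a), φ u / (u : ℂ) with hf₀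
  set C : ℂ := -∫ u in Ioi a, φ u / (u : ℂ) with hC
  have hle : ∀ t : ℝ, t ≤ a → f₀ t = C := by
    intro t ht
    simp only [hf₀, hC]
    rw [hφ0 t ht, BurnolTailAvg.tailAvg_of_le φ ht, zero_sub]
  -- the `L²(a,∞)` piece: `𝟙_{(a,∞)}f₀ = 𝟙_{(a,∞)}φ − 𝟙_{(a,∞)}·(tail integral)` (Hardy)
  have hpiece : (Ioi a).indicator f₀ = fun t : ℝ ↦ (Ioi a).indicator φ t -
      (Ioi a).indicator (fun t : ℝ ↦ ∫ u in Ioi t, φ u / (u : ℂ)) t := by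
    funext t
    by_cases ht : t ∈ Ioi a
    · rw [indicator_of_mem ht, indicator_of_mem ht, indicator_of_mem ht]
      simp only [hf₀]
      rw [BurnolTailAvg.tailAvg_of_ge φ (le_of_lt ht)]
    · rw [indicator_of_notMem ht, indicator_of_notMem ht, indicator_of_notMem ht, sub_zero]
  have hg₁ : MemLp ((Ioi a).indicator f₀) 2 (volume : Measure ℝ) := by
    rw [hpiece]
    exact (hφ2.indicator measurableSet_Ioi).sub (TailFactor.memLp_indicator_tailIntegral ha hφm hφ2).1
  have hdecomp : (Ioi (0:ℝ)).indicator f₀ =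
      fun t : ℝ ↦ (Ioc 0 a).indicator (fun _ : ℝ ↦ C) t + (Ioi a).indicator f₀ t := by
    funext t
    by_cases ht0 : t ∈ Ioi (0:ℝ)
    · rw [indicator_of_mem ht0]
      by_cases hta : t ≤ a
      · have h1 : t ∈ Ioc (0:ℝ) a := ⟨ht0, hta⟩
        have h2 : t ∉ Ioi a := fun h ↦ not_lt.2 hta h
        rw [indicator_of_mem h1, indicator_of_notMem h2, add_zero, hle t hta]
      · have h1 : t ∉ Ioc (0:ℝ) a := fun h ↦ hta h.2
        have h2 : t ∈ Ioi a := lt_of_not_ge hta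
        rw [indicator_of_notMem h1, indicator_of_mem h2, zero_add]
    · have ht0' : t ≤ 0 := not_lt.1 ht0
      have h1 : t ∉ Ioc (0:ℝ) a := fun h ↦ ht0 h.1
      have h2 : t ∉ Ioi a := fun h ↦ ht0 (ha.trans h)
      rw [indicator_of_notMem ht0, indicator_of_notMem h1, indicator_of_notMem h2, add_zero]
  have hind : MemLp ((Ioc 0 a).indicator fun _ : ℝ ↦ C) 2 (volume : Measure ℝ) :=
    memLp_indicator_const 2 measurableSet_Ioc C (Or.inr measure_Ioc_lt_top.ne)
  have hk₀ : MemLp ((Ioi (0:ℝ)).indicator f₀) 2 (volume : Measure ℝ) := by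
    rw [hdecomp]
    exact hind.add hg₁
  refine ⟨f₀, C, hle, hg₁, hdecomp, hk₀, fun s hs1 hs2 ↦ ⟨?_, (hstrip s hs1 hs2).2⟩⟩
  exact (hasMellin_sub (BurnolTailAvg.mellinConvergent_of_memLp ha hφ2 hφ0' hs1)
    (hstrip s hs1 hs2).1).1

/-! ## D. The Mellin–Plancherel transform of the preimage on the critical line -/

/-- `𝓜(𝟙_{(0,∞)}f₀)(s) = 𝓜f₀(s)`: the Mellin transform only sees `(0,∞)`. [folklore] -/
private theorem mellin_indicator_Ioi (f₀ : ℝ → ℂ) (s : ℂ) :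
    mellin ((Ioi (0:ℝ)).indicator f₀) s = mellin f₀ s := by
  refine setIntegral_congr_fun measurableSet_Ioi fun t ht ↦ ?_
  simp only [indicator_of_mem ht]

/-- `MellinConvergent (𝟙_{(0,∞)}f₀) s ↔ MellinConvergent f₀ s`. [folklore] -/
private theorem mellinConvergent_indicator_Ioi (f₀ : ℝ → ℂ) (s : ℂ) :
    MellinConvergent ((Ioi (0:ℝ)).indicator f₀) s ↔ MellinConvergent f₀ s := by
  refine integrableOn_congr_fun (fun t ht ↦ ?_) measurableSet_Ioi
  simp only [indicator_of_mem ht]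

/-- Continuity of `K(s) = G(1−s) − C·a^s/s` at the points of the critical line (`G` holomorphic off
`s = 1`; on the line `s ≠ 0`, `1 − s ≠ 1`). [folklore] -/
private theorem continuousAt_K (ha : 0 < a) {G : ℂ → ℂ} (hG : DifferentiableOn ℂ G {s | s ≠ 1})
    (C : ℂ) (ξ : ℝ) :
    ContinuousAt (fun s : ℂ ↦ G (1 - s) - C * (a : ℂ) ^ s / s) (1 / 2 + 2 * π * ξ * I) := by
  have hs0 : (1 / 2 + 2 * π * ξ * I : ℂ) ≠ 0 := by
    intro h
    have := congrArg Complex.re h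
    simp at this
  have h1 : ContinuousAt (fun s : ℂ ↦ G (1 - s)) (1 / 2 + 2 * π * ξ * I) := by
    have hmem : (1 - (1 / 2 + 2 * π * ξ * I) : ℂ) ∈ {s : ℂ | s ≠ 1} := by
      intro h
      have := congrArg Complex.re h
      simp at this
    have hGc : ContinuousAt G (1 - (1 / 2 + 2 * π * ξ * I)) :=
      (hG.continuousOn.continuousAt (isOpen_ne.mem_nhds hmem))
    exact hGc.comp (continuousAt_const.sub continuousAt_id)
  have h2 : ContinuousAt (fun s : ℂ ↦ C * (a : ℂ) ^ s / s) (1 / 2 + 2 * π * ξ * I) :=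
    ((continuousAt_const.mul (continuousAt_const_cpow (ofReal_ne_zero.2 ha.ne'))).div
      continuousAt_id hs0)
  exact h1.sub h2

/-- **`𝓜[𝟙_{(0,∞)}f₀] = (ξ ↦ G(½ − 2πiξ))`** almost everywhere, for the preimage `f₀` of
`exists_preimage` (decomposed as `C·𝟙_{(0,a]} + g₁`, `g₁ = 𝟙_{(a,∞)}f₀ ∈ L²`, `f̂₀ = G` on the
strip), GIVEN the boundary-value lemma (B4) for `L²(a,∞)` (hypothesis `hBV`): the indicator part is
`𝓜(C𝟙)(s) = C a^s/s` on the line itself (absolute convergence), the `g₁` part is the boundary value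
of `K(s) = 𝓜g₁(s) = G(1−s) − C a^s/s` from the left strip `0 < Re s < ½`.
[cite: Burnol2004b, Prop. 4.1, proof (arXiv:math/0203120v7 p. 7, TeX l.656–669)] -/
theorem mellinL2_preimage_of_boundaryValues (ha : 0 < a)
    (hBV : ∀ {k : ℝ → ℂ} (hk2 : MemLp k 2 (volume.restrict (Ioi (0:ℝ))))
      (_hk0 : ∀ᵐ t ∂(volume.restrict (Ioi (0:ℝ))), t ≤ a → k t = 0) {K : ℂ → ℂ}
      (_hK : ∀ s : ℂ, 0 < s.re → s.re < 1 / 2 → mellin k s = K s)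
      (_hKc : ∀ ξ : ℝ, ContinuousAt K (1 / 2 + 2 * π * ξ * I)),
      (mellinL2 (hk2.toLp k) : ℝ → ℂ) =ᵐ[volume] fun ξ ↦ K (1 / 2 + 2 * π * ξ * I))
    {G : ℂ → ℂ} (hG : DifferentiableOn ℂ G {s | s ≠ 1}) {f₀ : ℝ → ℂ} {C : ℂ}
    (hg₁ : MemLp ((Ioi a).indicator f₀) 2 (volume : Measure ℝ))
    (hdecomp : (Ioi (0:ℝ)).indicator f₀ =
      fun t : ℝ ↦ (Ioc 0 a).indicator (fun _ : ℝ ↦ C) t + (Ioi a).indicator f₀ t)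
    (hk₀ : MemLp ((Ioi (0:ℝ)).indicator f₀) 2 (volume : Measure ℝ))
    (hstrip : ∀ s : ℂ, 1 / 2 < s.re → s.re < 1 → MellinConvergent f₀ (1 - s) ∧ rightMellin f₀ s = G s) :
    (mellinL2 ((hk₀.restrict (Ioi (0:ℝ))).toLp ((Ioi (0:ℝ)).indicator f₀)) : ℝ → ℂ) =ᵐ[volume]
      fun ξ : ℝ ↦ G (1 - (1 / 2 + 2 * π * ξ * I)) := by
  have hind : MemLp ((Ioc 0 a).indicator fun _ : ℝ ↦ C) 2 (volume : Measure ℝ) :=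
    memLp_indicator_const 2 measurableSet_Ioc C (Or.inr measure_Ioc_lt_top.ne)
  have hindr := hind.restrict (Ioi (0:ℝ))
  have hg₁r := hg₁.restrict (Ioi (0:ℝ))
  -- the class of `𝟙_{(0,∞)}f₀` is the sum of the two classes
  have hsum : (hk₀.restrict (Ioi (0:ℝ))).toLp ((Ioi (0:ℝ)).indicator f₀) =
      hindr.toLp _ + hg₁r.toLp _ := by
    rw [← MemLp.toLp_add]
    exact MemLp.toLp_congr _ _ (Eventually.of_forall fun t ↦ by rw [hdecomp]; rfl)
  -- indicator part: absolute convergence on the line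
  have hI : (mellinL2 (hindr.toLp _) : ℝ → ℂ) =ᵐ[volume]
      fun ξ ↦ C * (a : ℂ) ^ (1 / 2 + 2 * π * ξ * I : ℂ) / (1 / 2 + 2 * π * ξ * I) := by
    refine (mellinL2_toLp_ae_eq_mellin hindr (hasMellin_indicator_const ha C (s := 1 / 2)
      (by norm_num)).1).trans (Eventually.of_forall fun ξ ↦ ?_)
    exact (hasMellin_indicator_const ha C (s := 1 / 2 + 2 * π * ξ * I) (by simp)).2
  -- `g₁` part: boundary values of `K(s) = G(1−s) − C a^s/s`
  have hg₁0 : ∀ᵐ t ∂(volume.restrict (Ioi (0:ℝ))), t ≤ a → (Ioi a).indicator f₀ t = 0 :=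
    Eventually.of_forall fun t ht ↦ indicator_of_notMem (fun h : t ∈ Ioi a ↦ not_lt.2 ht h) _
  have hK : ∀ s : ℂ, 0 < s.re → s.re < 1 / 2 →
      mellin ((Ioi a).indicator f₀) s = G (1 - s) - C * (a : ℂ) ^ s / s := by
    intro s hs0 hs
    have h1s1 : 1 / 2 < (1 - s).re := by simp only [sub_re, one_re]; linarith
    have h1s2 : (1 - s).re < 1 := by simp only [sub_re, one_re]; linarith
    have hf₀c : MellinConvergent ((Ioi (0:ℝ)).indicator f₀) s := by
      rw [mellinConvergent_indicator_Ioi]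
      have h := (hstrip (1 - s) h1s1 h1s2).1
      rwa [sub_sub_cancel] at h
    have hf₀v : mellin ((Ioi (0:ℝ)).indicator f₀) s = G (1 - s) := by
      rw [mellin_indicator_Ioi]
      have h := (hstrip (1 - s) h1s1 h1s2).2
      rwa [rightMellin, sub_sub_cancel] at h
    have hIc := hasMellin_indicator_const ha C hs0
    have heq : (Ioi a).indicator f₀ =
        fun t ↦ (Ioi (0:ℝ)).indicator f₀ t - (Ioc 0 a).indicator (fun _ : ℝ ↦ C) t := by
      funext t
      rw [hdecomp]
      ring
    rw [heq, (hasMellin_sub hf₀c hIc.1).2, hf₀v, hIc.2]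
  have hII := hBV hg₁r hg₁0 hK (continuousAt_K ha hG C)
  rw [hsum, map_add]
  filter_upwards [Lp.coeFn_add (mellinL2 (hindr.toLp _)) (mellinL2 (hg₁r.toLp _)), hI, hII]
    with ξ hadd h1 h2
  rw [hadd, Pi.add_apply, h1, h2]
  ring

/-! ## E. The `𝓕`-side: `𝓕u = v` by the multiplier identity and the functional equation -/

/-- Two almost-everywhere even `L²(ℝ)` classes with the same restriction to `(0,∞)` are equal.
[folklore] -/
private theorem eq_of_even_of_restrict_eq {u v : Lp ℂ 2 (volume : Measure ℝ)}
    (hu : ∀ᵐ x : ℝ, (u : ℝ → ℂ) (-x) = (u : ℝ → ℂ) x)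
    (hv : ∀ᵐ x : ℝ, (v : ℝ → ℂ) (-x) = (v : ℝ → ℂ) x)
    (h : LpToLpRestrictCLM ℝ ℂ ℂ (volume : Measure ℝ) 2 (Ioi (0:ℝ)) u =
      LpToLpRestrictCLM ℝ ℂ ℂ (volume : Measure ℝ) 2 (Ioi (0:ℝ)) v) :
    u = v := by
  have h1 := LpToLpRestrictCLM_coeFn ℂ (Ioi (0:ℝ)) u (p := 2)
  have h2 := LpToLpRestrictCLM_coeFn ℂ (Ioi (0:ℝ)) v (p := 2)
  rw [h] at h1
  have h3 : ∀ᵐ x : ℝ, x ∈ Ioi (0:ℝ) → (u : ℝ → ℂ) x = (v : ℝ → ℂ) x := by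
    rw [← ae_restrict_iff' measurableSet_Ioi]
    filter_upwards [h1, h2] with x hx1 hx2
    rw [← hx1, hx2]
  have hq : Measure.QuasiMeasurePreserving (fun x : ℝ => -x) volume volume :=
    (Measure.measurePreserving_neg (volume : Measure ℝ)).quasiMeasurePreserving
  have h0 : ∀ᵐ x : ℝ, x ≠ 0 := by
    have : (volume : Measure ℝ) {x | ¬ x ≠ 0} = 0 := by simp
    exact ae_iff.2 this
  apply Lp.ext
  filter_upwards [h3, hq.ae h3, hu, hv, h0] with x hpos hneg heu hev hx0
  rcases lt_or_gt_of_ne hx0 with hx | hx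
  · rw [← heu, ← hev]
    exact hneg (by simpa using hx)
  · exact hpos hx

/-- The `L²` class of an (everywhere) even function is almost-everywhere even. [folklore] -/
private theorem ae_even_toLp {u : ℝ → ℂ} (hu2 : MemLp u 2 (volume : Measure ℝ))
    (hu : ∀ x, u (-x) = u x) :
    ∀ᵐ x : ℝ, (hu2.toLp u : ℝ → ℂ) (-x) = (hu2.toLp u : ℝ → ℂ) x := by
  have hq : Measure.QuasiMeasurePreserving (fun x : ℝ => -x) volume volume :=
    (Measure.measurePreserving_neg (volume : Measure ℝ)).quasiMeasurePreserving
  filter_upwards [hu2.coeFn_toLp, hq.ae_eq hu2.coeFn_toLp] with x h1 h2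
  simp only [Function.comp_apply] at h2
  rw [h1, h2, hu]

/-- The restriction to `(0,∞)` of the class of the even extension of `f₀` is the `L²(0,∞)` class of
`𝟙_{(0,∞)}f₀`. [folklore] -/
private theorem restrict_toLp_evenExt {f₀ : ℝ → ℂ} (hk₀ : MemLp ((Ioi (0:ℝ)).indicator f₀) 2 volume) :
    LpToLpRestrictCLM ℝ ℂ ℂ (volume : Measure ℝ) 2 (Ioi (0:ℝ)) ((memLp_evenExt hk₀).toLp _) =
      (hk₀.restrict (Ioi (0:ℝ))).toLp ((Ioi (0:ℝ)).indicator f₀) := by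
  apply Lp.ext
  have h1 := LpToLpRestrictCLM_coeFn ℂ (Ioi (0:ℝ))
    ((memLp_evenExt hk₀).toLp _ : Lp ℂ 2 (volume : Measure ℝ)) (p := 2)
  have h2 := ae_restrict_of_ae (s := Ioi (0:ℝ)) (memLp_evenExt hk₀).coeFn_toLp
  have h3 := (hk₀.restrict (Ioi (0:ℝ))).coeFn_toLp
  filter_upwards [h1, h2, h3, ae_restrict_mem measurableSet_Ioi] with x hx1 hx2 hx3 hx
  rw [hx1, hx2, hx3, evenExt_of_pos f₀ hx, indicator_of_mem hx]

/-- The right Mellin transform of a representative of the even extension is that of `f₀`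
(the transform only sees `(0,∞)`, where they agree a.e.). [folklore] -/
private theorem rightMellin_congr_Ioi {g f₀ : ℝ → ℂ}
    (h : ∀ᵐ t : ℝ, t ∈ Ioi (0:ℝ) → g t = f₀ t) (s : ℂ) :
    rightMellin g s = rightMellin f₀ s := by
  simp only [rightMellin, mellin]
  refine setIntegral_congr_ae measurableSet_Ioi ?_
  filter_upwards [h] with t ht hmem
  rw [ht hmem]

/-- The functional equation read on the critical line: from `Γℝ(s)H(s) = Γℝ(1−s)G(1−s)` (off the
poles) at `s = ½ − 2πiξ`: `H(½ − 2πiξ) = (Γℝ(½+2πiξ)/Γℝ(½−2πiξ))·G(½+2πiξ)`.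
[cite: Burnol2004b, §1 p. 4 (arXiv:math/0203120v7, TeX l.348–363)] -/
private theorem fe_on_line {G H : ℂ → ℂ}
    (hFE : ∀ s : ℂ, (∀ n : ℕ, s ≠ -2 * (n : ℂ)) → (∀ n : ℕ, s ≠ 1 + 2 * (n : ℂ)) →
      Gammaℝ s * H s = Gammaℝ (1 - s) * G (1 - s)) (ξ : ℝ) :
    H (1 / 2 - 2 * π * ξ * I) = Gammaℝ (1 / 2 + 2 * π * ξ * I) / Gammaℝ (1 / 2 - 2 * π * ξ * I) *
      G (1 / 2 + 2 * π * ξ * I) := by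
  have hn1 : ∀ n : ℕ, (1 / 2 - 2 * π * ξ * I : ℂ) ≠ -2 * (n : ℂ) := by
    intro n h
    have := congrArg Complex.re h
    simp at this
    linarith [n.cast_nonneg (α := ℝ)]
  have hn2 : ∀ n : ℕ, (1 / 2 - 2 * π * ξ * I : ℂ) ≠ 1 + 2 * (n : ℂ) := by
    intro n h
    have := congrArg Complex.re h
    simp at this
    linarith [n.cast_nonneg (α := ℝ)]
  have h := hFE _ hn1 hn2
  have e : (1 - (1 / 2 - 2 * π * ξ * I) : ℂ) = 1 / 2 + 2 * π * ξ * I := by ring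
  rw [e] at h
  have key : ∀ (Hs Gs Γs Γs' : ℂ), Γs' ≠ 0 → Γs' * Hs = Γs * Gs → Hs = Γs / Γs' * Gs := by
    intro Hs Gs Γs Γs' hne hh
    field_simp
    linear_combination hh
  exact key _ _ _ _ (Gammaℝ_line_neg_ne_zero ξ) h

/-- **Prop. 4.1 (ii) with the `𝓕`-side export, under the boundary-value lemma (B4).** For
`a > 0` and `G, H` holomorphic off `s = 1` with `Γℝ(s)H(s) = Γℝ(1−s)G(1−s)` off the poles of the
`Γ`-factors, if both `G` and `H` lie in `(s/(s−1))A^sℍ²` (pole-tolerant form: some `F ∈ ℍ²` agrees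
with `a^s((s−1)/s)G(s)` on `{Re s > ½} ∖ {1}`, and likewise for `H`), then there is `f ∈ L_a` with
`f̂(s) = G(s)` and `(𝓕f)^(s) = H(s)` on the strip `½ < Re s < 1` ("If moreover `χ(s)F(1−s)` also
belongs to `(s/(s−1))A^sℍ²` then … `f ∈ L_a`"). Proof: `u, v` = even extensions of the two
preimages; `𝓜(res 𝓕u)(ξ) = (Γℝ(s)/Γℝ(1−s))·𝓜(res u)(−ξ) = (Γℝ(s)/Γℝ(1−s))·G(s) = H(1−s) =
𝓜(res v)(ξ)` (`s = ½ + 2πiξ`; multiplier identity `mellinL2_restrict_fourier_of_even`, row M2, and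
the functional equation), so `𝓕u = v`. [cite: Burnol2004b, Prop. 4.1 (arXiv:math/0203120v7 p. 7, TeX l.646–669)] -/
theorem exists_mem_sonineL_of_boundaryValues (ha : 0 < a)
    (hBV : ∀ {k : ℝ → ℂ} (hk2 : MemLp k 2 (volume.restrict (Ioi (0:ℝ))))
      (_hk0 : ∀ᵐ t ∂(volume.restrict (Ioi (0:ℝ))), t ≤ a → k t = 0) {K : ℂ → ℂ}
      (_hK : ∀ s : ℂ, 0 < s.re → s.re < 1 / 2 → mellin k s = K s)
      (_hKc : ∀ ξ : ℝ, ContinuousAt K (1 / 2 + 2 * π * ξ * I)),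
      (mellinL2 (hk2.toLp k) : ℝ → ℂ) =ᵐ[volume] fun ξ ↦ K (1 / 2 + 2 * π * ξ * I))
    {G H : ℂ → ℂ} (hG : DifferentiableOn ℂ G {s | s ≠ 1}) (hH : DifferentiableOn ℂ H {s | s ≠ 1})
    (hFE : ∀ s : ℂ, (∀ n : ℕ, s ≠ -2 * (n : ℂ)) → (∀ n : ℕ, s ≠ 1 + 2 * (n : ℂ)) →
      Gammaℝ s * H s = Gammaℝ (1 - s) * G (1 - s))
    (hG2 : ∃ F : ℂ → ℂ, IsHardyRight F ∧ ∀ s : ℂ, 1 / 2 < s.re → s ≠ 1 →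
      F s = (a : ℂ) ^ s * ((s - 1) / s) * G s)
    (hH2 : ∃ F : ℂ → ℂ, IsHardyRight F ∧ ∀ s : ℂ, 1 / 2 < s.re → s ≠ 1 →
      F s = (a : ℂ) ^ s * ((s - 1) / s) * H s) :
    ∃ f ∈ sonineL a, (∀ s : ℂ, 1 / 2 < s.re → s.re < 1 → rightMellin f s = G s) ∧
      ∀ s : ℂ, 1 / 2 < s.re → s.re < 1 →
        rightMellin ((𝓕 f : Lp ℂ 2 (volume : Measure ℝ)) : ℝ → ℂ) s = H s := by
  obtain ⟨f₀, C, hle, hg₁, hdecomp, hk₀, hstrip⟩ := exists_preimage ha hG2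
  obtain ⟨h₀, D, hleH, hg₁H, hdecompH, hk₀H, hstripH⟩ := exists_preimage ha hH2
  -- the even extensions and their classes
  set u : ℝ → ℂ := fun x ↦ (Ioi (0:ℝ)).indicator f₀ x + (Ioi (0:ℝ)).indicator f₀ (-x) with hudef
  set v : ℝ → ℂ := fun x ↦ (Ioi (0:ℝ)).indicator h₀ x + (Ioi (0:ℝ)).indicator h₀ (-x) with hvdef
  have hu2 : MemLp u 2 (volume : Measure ℝ) := memLp_evenExt hk₀
  have hv2 : MemLp v 2 (volume : Measure ℝ) := memLp_evenExt hk₀H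
  have hue : ∀ x, u (-x) = u x := fun x ↦ evenExt_neg f₀ x
  have hve : ∀ x, v (-x) = v x := fun x ↦ evenExt_neg h₀ x
  set U : Lp ℂ 2 (volume : Measure ℝ) := hu2.toLp u with hUdef
  set V : Lp ℂ 2 (volume : Measure ℝ) := hv2.toLp v with hVdef
  have hUe : ∀ᵐ x : ℝ, (U : ℝ → ℂ) (-x) = (U : ℝ → ℂ) x := ae_even_toLp hu2 hue
  have hVe : ∀ᵐ x : ℝ, (V : ℝ → ℂ) (-x) = (V : ℝ → ℂ) x := ae_even_toLp hv2 hve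
  -- Mellin–Plancherel transforms of the restrictions
  have hresU : LpToLpRestrictCLM ℝ ℂ ℂ (volume : Measure ℝ) 2 (Ioi (0:ℝ)) U =
      (hk₀.restrict (Ioi (0:ℝ))).toLp ((Ioi (0:ℝ)).indicator f₀) := restrict_toLp_evenExt hk₀
  have hresV : LpToLpRestrictCLM ℝ ℂ ℂ (volume : Measure ℝ) 2 (Ioi (0:ℝ)) V =
      (hk₀H.restrict (Ioi (0:ℝ))).toLp ((Ioi (0:ℝ)).indicator h₀) := restrict_toLp_evenExt hk₀H
  have hMU := mellinL2_preimage_of_boundaryValues ha hBV hG hg₁ hdecomp hk₀ hstrip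
  have hMV := mellinL2_preimage_of_boundaryValues ha hBV hH hg₁H hdecompH hk₀H hstripH
  -- `𝓜(res 𝓕U) = 𝓜(res V)`
  have hq : Measure.QuasiMeasurePreserving (fun x : ℝ => -x) volume volume :=
    (Measure.measurePreserving_neg (volume : Measure ℝ)).quasiMeasurePreserving
  have hMU' : (fun ξ : ℝ ↦ (mellinL2 (LpToLpRestrictCLM ℝ ℂ ℂ (volume : Measure ℝ) 2 (Ioi (0:ℝ)) U) :
      ℝ → ℂ) (-ξ)) =ᵐ[volume] fun ξ ↦ G (1 / 2 + 2 * π * ξ * I) := by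
    rw [hresU]
    filter_upwards [hq.ae_eq hMU] with ξ h
    simp only [Function.comp_apply] at h
    rw [h]
    congr 1
    push_cast
    ring
  have hFU : mellinL2 (LpToLpRestrictCLM ℝ ℂ ℂ (volume : Measure ℝ) 2 (Ioi (0:ℝ))
      (𝓕 U : Lp ℂ 2 (volume : Measure ℝ))) =
      mellinL2 (LpToLpRestrictCLM ℝ ℂ ℂ (volume : Measure ℝ) 2 (Ioi (0:ℝ)) V) := by
    apply Lp.ext
    rw [hresV]
    filter_upwards [mellinL2_restrict_fourier_of_even hUe, hMU', hMV] with ξ h1 h2 h3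
    rw [h1, h2, h3, ← fe_on_line hFE ξ]
    congr 1
    ring
  have hFUV : (𝓕 U : Lp ℂ 2 (volume : Measure ℝ)) = V :=
    eq_of_even_of_restrict_eq (fourier_mem_evenL2 hUe) hVe (mellinL2.injective hFU)
  -- conclusion
  refine ⟨U, ⟨hUe, ⟨C, ?_⟩, ⟨D, ?_⟩⟩, fun s hs1 hs2 ↦ ?_, fun s hs1 hs2 ↦ ?_⟩
  · filter_upwards [hu2.coeFn_toLp] with x hx hxa
    rw [hx, hudef]
    dsimp only
    rw [evenExt_of_pos f₀ hxa.1, hle x hxa.2.le]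
  · rw [hFUV]
    filter_upwards [hv2.coeFn_toLp] with x hx hxa
    rw [hx, hvdef]
    dsimp only
    rw [evenExt_of_pos h₀ hxa.1, hleH x hxa.2.le]
  · rw [← (hstrip s hs1 hs2).2]
    refine rightMellin_congr_Ioi ?_ s
    filter_upwards [hu2.coeFn_toLp] with t ht hmem
    rw [ht, hudef]
    exact evenExt_of_pos f₀ hmem
  · rw [hFUV, ← (hstripH s hs1 hs2).2]
    refine rightMellin_congr_Ioi ?_ s
    filter_upwards [hv2.coeFn_toLp] with t ht hmem
    rw [ht, hvdef]
    exact evenExt_of_pos h₀ hmem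

/-- **`Burnol2004b_prop4_1R`, clause (ii), under the boundary-value lemma (B4)**: verbatim the second
conjunct of the repaired Prop. 4.1 — a function `G` holomorphic on `ℂ ∖ {1}` such that `G` and its
"Fourier transform" `H` (`Γ_ℝ(s)H(s) = Γ_ℝ(1−s)G(1−s)`) both lie in `(s/(s−1))A^s ℍ²` is `f̂` for some
`f ∈ L_a`. [cite: Burnol2004b, Prop. 4.1 (arXiv:math/0203120v7 p. 7, TeX l.646–669)] -/
theorem prop4_1R_ii_of_boundaryValues (ha : 0 < a)
    (hBV : ∀ {k : ℝ → ℂ} (hk2 : MemLp k 2 (volume.restrict (Ioi (0:ℝ))))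
      (_hk0 : ∀ᵐ t ∂(volume.restrict (Ioi (0:ℝ))), t ≤ a → k t = 0) {K : ℂ → ℂ}
      (_hK : ∀ s : ℂ, 0 < s.re → s.re < 1 / 2 → mellin k s = K s)
      (_hKc : ∀ ξ : ℝ, ContinuousAt K (1 / 2 + 2 * π * ξ * I)),
      (mellinL2 (hk2.toLp k) : ℝ → ℂ) =ᵐ[volume] fun ξ ↦ K (1 / 2 + 2 * π * ξ * I)) :
    ∀ G H : ℂ → ℂ, DifferentiableOn ℂ G {s | s ≠ 1} → DifferentiableOn ℂ H {s | s ≠ 1} →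
      (∀ s : ℂ, (∀ n : ℕ, s ≠ -2 * (n : ℂ)) → (∀ n : ℕ, s ≠ 1 + 2 * (n : ℂ)) →
        Gammaℝ s * H s = Gammaℝ (1 - s) * G (1 - s)) →
      (∃ F : ℂ → ℂ, IsHardyRight F ∧ ∀ s : ℂ, 1 / 2 < s.re → s ≠ 1 →
        F s = (a : ℂ) ^ s * ((s - 1) / s) * G s) →
      (∃ F : ℂ → ℂ, IsHardyRight F ∧ ∀ s : ℂ, 1 / 2 < s.re → s ≠ 1 →
        F s = (a : ℂ) ^ s * ((s - 1) / s) * H s) →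
      ∃ f ∈ sonineL a, ∀ s : ℂ, 1 / 2 < s.re → s.re < 1 → rightMellin f s = G s := by
  intro G H hG hH hFE hG2 hH2
  obtain ⟨f, hf, hfG, -⟩ := exists_mem_sonineL_of_boundaryValues ha hBV hG hH hFE hG2 hH2
  exact ⟨f, hf, hfG⟩

end BurnolHardyConverse

end Literature.NumberTheory.LFunctions

end
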